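import Summits.HodgeConjecture.CorCM.IrreducibleOddWeightsDRankCMFields
import HarnessLib

/-!
# Multiplicity one ((SC) fields): `dim U(Σ) = n · rank_ℚ(u_1, …, u_k)` — the dimension of the Hodge group of ANY
# product of abelian varieties with CM by one (SC) field is `n` times the linear rank of the type vectors

COR-CM (cell `pub-hodgecm2`, binder seat `b16` gen 56, count-neutral claim MAX-NONDEG (D-RANK), file F6 — abstract
`G`-set level and CM dress; sequel of F2/F5; theorems only, no definition, no named fact, no `sorry`).  NEW as stated,
hence under `Summits/`.  HONEST FRAMING: finite-dimensional linear algebra about the Kubota–Dodson rank of SAME-SLOT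
families of CM types, read on Hodge groups of products of abelian varieties with CM by ONE field; `HC_CM` is neither
used nor asserted.

Under MULTIPLICITY ONE (M1) of the odd weights (every equivariant odd-valued endomorphism of `ℚ^X` is a multiple of
`f ↦ f − f∘ρ`; for CM fields ⟺ (SC) «self-conjugate stabiliser orbits», seat gen 54) the commutant is `ℚ`, so the
`D`-rank of F3 is the ordinary LINEAR rank of the `±1` type vectors `u_i = 𝟙_{Φ_i} − 𝟙_{Φ̄_i}`.  The tree decides the
nondegenerate case (`forall_map_slotExt_le_iff_linearIndependent_of_isCMTypeWith`: additive ⟺ linearly independent);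
this file gives the dimension in ALL cases:

> **`finrank_antiSpan_sigmaType_eq_finrank_span_mul`** — under (M1), for every same-slot family of CM types:
> `dim U(Σ) = dim span_ℚ{u_i : i ∈ I} · (|X|/2)`, `rank(Σ) = n · rank_ℚ(u_1, …, u_k) + 1`
> (`typeRank_sigmaType_eq_finrank_span_mul_add_one`).

> **`cmFamilyRank_eq_finrank_span_mul_of_stabConj`** — for an (SC) CM field `K` of degree `2n` and ANY CM types
> `Φ_1, …, Φ_k` of `K`: `rank(Φ) = n · dim span_ℚ{u_{Φ_1}, …, u_{Φ_k}} + 1`, i.e.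
> **`dim Hg(A_1 × ⋯ × A_k) = n · rank_ℚ(u_{Φ_1}, …, u_{Φ_k})`** for abelian varieties `A_i` with CM by `(K, Φ_i)` — a
> closed formula for every product of (not necessarily distinct, not necessarily simple… they are simple) CM abelian
> varieties with CM by one (SC) field (all «generic» CM fields, 19 of the 38 octic Galois types, …).

PROOF.  A maximal linearly independent sub-family `s` (Mathlib `exists_maximal_linearIndepOn'`) is a maximal additive
one (tree criterion on every sub-family), so F2 gives `dim U(Σ) = |s| · dim Anti = |s| · n`; maximality makes every
`u_i` lie in `span{u_j : j ∈ s}`, so `|s| = dim span{u_i}`.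

## References

* [Mai1989] L. Mai, *Lower bounds for the ranks of CM types*, J. Number Theory 32 (1989), §2 Prop. 1 (proof).
* [Kubota1965] T. Kubota, *On the field extension by complex multiplication*, Trans. AMS 118 (1965), §2 Lemma 2.
* [Gordon1999HodgeAVSurvey] B. B. Gordon, *A survey of the Hodge conjecture for abelian varieties*, §3 Theorem (proof),
  7.5–7.7, 9.1.
* [Wielandt1964] H. Wielandt, *Finite Permutation Groups* (1964), Thm. 28.4.
-/

set_option autoImplicit false

noncomputable section

open scoped BigOperators

namespace Summit.HodgeConjecture.CorCM.IrrOdd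

open Literature.NumberTheory.ComplexMultiplication

variable {G : Type*} [Group G] {I : Type*} {X : Type*} [MulAction G X]

/-! ### §1 Multiplicity one: `dim U(Σ) = rank_ℚ(u_i) · (|X|/2)` -/

section LinearRank

variable [DecidableEq I] [Fintype I] [Fintype X] [Nonempty X] {ρ : G}

/-- **(M1): `dim U(Σ) = dim span_ℚ{u_1(Φ_i)} · (|X|/2)`** for every same-slot family of CM types — the `D`-rank of F3
is the linear rank of the type vectors when the commutant of the odd weights is `ℚ`.
[cite: Mai1989, §2 Prop. 1 (proof)] [cite: Kubota1965, §2 Lemma 2] [cite: Gordon1999HodgeAVSurvey, §3 Theorem (proof)] -/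
theorem finrank_antiSpan_sigmaType_eq_finrank_span_mul (Φ : I → Set X) (h : ∀ i, IsCMTypeWith ρ (Φ i))
    (hM1 : ∀ T : (X → ℚ) →ₗ[ℚ] (X → ℚ), (∀ (g : G) (f : X → ℚ), T (fun x => f (g⁻¹ • x)) = fun x => T f (g⁻¹ • x)) →
      (∀ f x, T f (ρ • x) = -T f x) → ∃ c : ℚ, ∀ f, T f = c • fun x => f x - f (ρ • x)) :
    Module.finrank ℚ (antiSpan G (sigmaType (E := fun _ : I => X) Φ)) =
      Module.finrank ℚ (Submodule.span ℚ (Set.range fun i => antiVec (Φ i) (1 : G))) * (Fintype.card X / 2) := by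
  classical
  rcases isEmpty_or_nonempty I with hI | ⟨⟨i₀⟩⟩
  · -- no slots: both sides vanish
    have h1 : antiSpan G (sigmaType (E := fun _ : I => X) Φ) = ⊥ := by
      rw [eq_bot_iff]
      intro f _
      rw [Submodule.mem_bot]
      funext x
      exact (IsEmpty.false x.1).elim
    have h2 : Submodule.span ℚ (Set.range fun i => antiVec (Φ i) (1 : G)) = ⊥ := by
      rw [Set.range_eq_empty, Submodule.span_empty]
    rw [h1, h2, finrank_bot, finrank_bot, zero_mul]
  -- a maximal linearly independent sub-family
  obtain ⟨s, hs, hsmax⟩ := exists_maximal_linearIndepOn' ℚ fun i => antiVec (Φ i) (1 : G)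
  -- under (M1): the odd weights are irreducible, met by every type
  have hirrA := antiWeights_irreducible_of_multiplicityOne (G := G) (h i₀).invol hM1
  have hU : ∀ i, antiSpan G (Φ i) = antiWeights (E := X) ρ := fun i =>
    antiSpan_eq_antiWeights_of_multiplicityOne (h i) hM1
  -- additive sub-families are the linearly independent ones
  have hiff : ∀ p : I → Prop,
      (∀ j : {i // p i}, (antiSpan G (Φ j.1)).map (slotExt (E := fun _ : {i // p i} => X) j) ≤
        antiSpan G (sigmaType (E := fun _ : {i // p i} => X) fun j => Φ j.1)) ↔
      LinearIndepOn ℚ (fun i => antiVec (Φ i) (1 : G)) {i | p i} := fun p =>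
    forall_map_slotExt_le_iff_linearIndependent_of_isCMTypeWith (fun j : {i // p i} => Φ j.1) (fun j => h j.1) hM1
  -- every type vector lies in the span of the chosen ones
  have hmem : ∀ i, antiVec (Φ i) (1 : G) ∈
      Submodule.span ℚ ((fun i => antiVec (Φ i) (1 : G)) '' s) := fun i =>
    hs.mem_span_iff.2 fun hli => by
      rw [hsmax _ (Set.subset_insert i s) hli]
      exact Set.mem_insert i s
  -- F2 on the maximal additive sub-family `s`
  have key := finrank_antiSpan_sigmaType_eq_sum_subtype_of_maximal (E := fun _ : I => X) Φ (· ∈ s)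
    (fun i _ => by rw [hU i]; exact hirrA) ((hiff (· ∈ s)).2 hs) fun i₁ hi₁ hadd => by
      have hli : LinearIndepOn ℚ (fun i => antiVec (Φ i) (1 : G)) (insert i₁ s) := by
        have h' := (hiff fun i => i ∈ s ∨ i = i₁).1 hadd
        rwa [show {i | i ∈ s ∨ i = i₁} = insert i₁ s from Set.ext fun i => or_comm] at h'
      exact hi₁ ((hsmax _ (Set.subset_insert i₁ s) hli).symm ▸ Set.mem_insert i₁ s)
  rw [key, Finset.sum_congr rfl fun j _ => by rw [hU j.1], Finset.sum_const, smul_eq_mul, Finset.card_univ,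
    finrank_antiWeights_eq_of_typeRank_eq (h i₀) (typeRank_eq_of_multiplicityOne (h i₀) hM1)]
  congr 1
  -- `|s| = dim span{u_i}`
  have himg : (Set.range fun j : s => antiVec (Φ j.1) (1 : G)) = (fun i => antiVec (Φ i) (1 : G)) '' s := by
    ext v
    constructor
    · rintro ⟨j, rfl⟩
      exact ⟨j.1, j.2, rfl⟩
    · rintro ⟨i, hi, rfl⟩
      exact ⟨⟨i, hi⟩, rfl⟩
  have hspan : Submodule.span ℚ (Set.range fun j : s => antiVec (Φ j.1) (1 : G)) =
      Submodule.span ℚ (Set.range fun i => antiVec (Φ i) (1 : G)) := by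
    rw [himg]
    exact le_antisymm (Submodule.span_mono (Set.image_subset_range _ _))
      (Submodule.span_le.2 (Set.range_subset_iff.2 fun i => hmem i))
  rw [← hspan, finrank_span_eq_card hs.linearIndependent]

/-- **(M1): `rank(Σ) = rank_ℚ(u_i) · (|X|/2) + 1`.** [cite: Mai1989, §2 Prop. 1 (proof)] [cite: Gordon1999HodgeAVSurvey, 9.1] -/
theorem typeRank_sigmaType_eq_finrank_span_mul_add_one [Nonempty I] (Φ : I → Set X)
    (h : ∀ i, IsCMTypeWith ρ (Φ i))
    (hM1 : ∀ T : (X → ℚ) →ₗ[ℚ] (X → ℚ), (∀ (g : G) (f : X → ℚ), T (fun x => f (g⁻¹ • x)) = fun x => T f (g⁻¹ • x)) →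
      (∀ f x, T f (ρ • x) = -T f x) → ∃ c : ℚ, ∀ f, T f = c • fun x => f x - f (ρ • x)) :
    typeRank G (sigmaType (E := fun _ : I => X) Φ) =
      Module.finrank ℚ (Submodule.span ℚ (Set.range fun i => antiVec (Φ i) (1 : G))) * (Fintype.card X / 2) + 1 := by
  haveI : Nonempty (Σ _ : I, X) := ⟨⟨Classical.arbitrary I, Classical.arbitrary X⟩⟩
  rw [(IsCMTypeWith.sigmaType (E := fun _ : I => X) h).typeRank_eq_finrank_antiSpan_add_one,
    finrank_antiSpan_sigmaType_eq_finrank_span_mul Φ h hM1]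

end LinearRank

end Summit.HodgeConjecture.CorCM.IrrOdd

/-! ### §2 CM fields with (M1) / (SC): `dim Hg(∏ A_i) = n · rank_ℚ(u_{Φ_1}, …, u_{Φ_k})` -/

namespace Summit.HodgeConjecture.CorCM

open NumberField
open Literature.NumberTheory.ComplexMultiplication
open Literature.AlgebraicGeometry.Motives (CMType)
open Literature.AlgebraicGeometry.Pohlmann1968
open GenericCMField

variable {K : Type} [Field K] [NumberField K] [IsCMField K] {I : Type} [Fintype I] [DecidableEq I] [Nonempty I]

/-- **(M1) field of degree `2n`: `rank(Φ) = n · dim span_ℚ{u_{Φ_i}} + 1`** for every family of CM types of `K` —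
`dim Hg(A_1 × ⋯ × A_k) = n · rank_ℚ(u_{Φ_1}, …, u_{Φ_k})`. [cite: Mai1989, §2 Prop. 1 (proof)]
[cite: Gordon1999HodgeAVSurvey, 9.1 and 7.5–7.7] -/
theorem cmFamilyRank_eq_finrank_span_mul_of_multiplicityOne
    (hM1 : ∀ T : ((K →+* ℂ) → ℚ) →ₗ[ℚ] ((K →+* ℂ) → ℚ),
      (∀ (g : ℂ ≃+* ℂ) (f : (K →+* ℂ) → ℚ), T (fun x => f (g⁻¹ • x)) = fun x => T f (g⁻¹ • x)) →
      (∀ (f : (K →+* ℂ) → ℚ) (x : K →+* ℂ), T f ((starRingAut : ℂ ≃+* ℂ) • x) = -T f x) →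
      ∃ c : ℚ, ∀ f, T f = c • fun x => f x - f ((starRingAut : ℂ ≃+* ℂ) • x))
    (Φ : I → CMType K) :
    CMAlgebra.cmFamilyRank (K := fun _ : I => K) Φ =
      Module.finrank ℚ (Submodule.span ℚ (Set.range fun i => antiVec (Φ i).1 (1 : ℂ ≃+* ℂ))) *
        (Module.finrank ℚ K / 2) + 1 := by
  rw [cmFamilyRank_eq_typeRank_sigmaType, ← Embeddings.card K ℂ]
  exact IrrOdd.typeRank_sigmaType_eq_finrank_span_mul_add_one (G := ℂ ≃+* ℂ) (fun i => (Φ i).1)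
    (fun i => isCMTypeWith_conj (Φ i)) hM1

/-- **(SC) FIELD OF DEGREE `2n`: `dim Hg(A_1 × ⋯ × A_k) = n · rank_ℚ(u_{Φ_1}, …, u_{Φ_k})`** —
`rank(Φ) = n · dim span_ℚ{u_{Φ_i}} + 1` for EVERY family of CM types of a CM field with self-conjugate stabiliser
orbits (every pair `x ∉ {x₀, x̄₀}` is carried to `x̄` by an automorphism of `ℂ` fixing `x₀`; all «generic» CM fields).
[cite: Wielandt1964, Thm. 28.4] [cite: Mai1989, §2 Prop. 1 (proof)] [cite: Gordon1999HodgeAVSurvey, 9.1 and 7.5–7.7] -/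
theorem cmFamilyRank_eq_finrank_span_mul_of_stabConj
    (hSC : ∀ x₀ x : K →+* ℂ, x ≠ x₀ → x ≠ (starRingAut : ℂ ≃+* ℂ) • x₀ →
      ∃ σ : ℂ ≃+* ℂ, σ • x₀ = x₀ ∧ σ • x = (starRingAut : ℂ ≃+* ℂ) • x)
    (Φ : I → CMType K) :
    CMAlgebra.cmFamilyRank (K := fun _ : I => K) Φ =
      Module.finrank ℚ (Submodule.span ℚ (Set.range fun i => antiVec (Φ i).1 (1 : ℂ ≃+* ℂ))) *
        (Module.finrank ℚ K / 2) + 1 :=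
  cmFamilyRank_eq_finrank_span_mul_of_multiplicityOne (fun T hT hodd => exists_smul_sub_of_stabConj hSC T hT hodd) Φ

/-- **(SC) field: the family is nondegenerate ⟺ `rank_ℚ(u_{Φ_1}, …, u_{Φ_k}) = k`** (recovering the tree's
independence criterion from the rank formula). [cite: Gordon1999HodgeAVSurvey, 7.5–7.7] -/
theorem isNondegenerateFamily_iff_finrank_span_eq_card_of_stabConj
    (hSC : ∀ x₀ x : K →+* ℂ, x ≠ x₀ → x ≠ (starRingAut : ℂ ≃+* ℂ) • x₀ →
      ∃ σ : ℂ ≃+* ℂ, σ • x₀ = x₀ ∧ σ • x = (starRingAut : ℂ ≃+* ℂ) • x)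
    (Φ : I → CMType K) :
    CMAlgebra.IsNondegenerateFamily (K := fun _ : I => K) Φ ↔
      Module.finrank ℚ (Submodule.span ℚ (Set.range fun i => antiVec (Φ i).1 (1 : ℂ ≃+* ℂ))) = Fintype.card I := by
  obtain ⟨s⟩ : Nonempty (K →+* ℂ) := inferInstance
  have hn : 0 < Module.finrank ℚ K / 2 :=
    Nat.div_pos (card_le_card_of_isNondegenerateFamily.two_le_finrank (Φ (Classical.arbitrary I))) two_pos
  rw [CMAlgebra.isNondegenerateFamily_iff, cmFamilyRank_eq_finrank_span_mul_of_stabConj hSC Φ, Finset.sum_const,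
    smul_eq_mul, Finset.card_univ,
    Nat.mul_div_assoc _ (cmFamilyRank_eq_cmFamilyRank_restrict_of_maximal.two_dvd_finrank (Φ (Classical.arbitrary I))),
    Nat.add_right_cancel_iff]
  exact ⟨fun h => Nat.eq_of_mul_eq_mul_right hn h, fun h => by rw [h]⟩

end Summit.HodgeConjecture.CorCM

end
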